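import Summits.BirchSwinnertonDyer.Rank1Residual.ManinAdditive.HalfTranslateTwistStep
import HarnessLib

/-!
# Crux `ManinOddAtFour` (route `ManinLocalTwoThree`, cell `bsd-f2-manin`), line `birth`, stub
# `stub_twistCoveredAtTwo` — its open core E-an-1 (Stevens' case `η = 2`), FILE 1: the newform-side
# lattice lemma K1 «`(g(χ)/2) · Λ(f ⊗ χ) ⊆ Λ(f)` for `χ = χ_{±8}` when `a₂(f)` is EVEN and the level of
# `f` is ODD» (Stevens 1989, (5.6)–(5.7), run on `Γ₀`)

Helper file for the crux item stmt-BirchSwinnertonDyer-22967 (`--supports`), prover seat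
`bsd-line-manin23-p3`. Setting: `f ∈ S₂(Γ₀(N))` with `N` odd, `χ` a primitive quadratic character mod `8`,
`L` a level with `N ∣ L`, `8² ∣ L`, `f ⊗ χ := charTwist L … f ∈ S₂(Γ₀(L))`, and the Hecke relation at `2`
for the modular symbols of `f` with an EVEN eigenvalue `a₂ = 2k`:
`2k · {∞, r}_f = {∞, r/2}_f + {∞, (r+1)/2}_f + {∞, 2r}_f` (for the newform of an elliptic curve good
at `2` this is the tree's `cuspCoeff_mul_modularSymbol` at `p = 2`). CLAIM (K1 of the cell memo
MEMO-an §3–§4): `(g(χ)/2) · z ∈ Λ(f)` for every `z ∈ Λ(f ⊗ χ)` — Stevens' Lemma (5.4) sharpened by his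
factor `η = 2` ((5.6)–(5.7), p. 97 L21 – p. 98 L9, there on `Γ₁`), the `TODO(η = 2)` left in
`Literature/…/Gamma1PeriodLatticeTwistProofs.lean`.

PROOF (generators `{∞, a/c}_{f⊗χ}`, `γ = (a b; c d) ∈ Γ₀(L)`, `c ≠ 0`, so `64 ∣ c`, `N ∣ c`, `a` odd):
by Birch's lemma `g(χ){∞, a/c}_{f⊗χ} = Σ_u χ(u) X_u`, `X_u = {∞, a/c + u/8}_f`, and for the primitive
characters mod `8`, `χ(u+4) = −χ(u)`, so the sum is `(X₁ − X₅) ± (X₃ − X₇)`. The Hecke relation at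
`s_u = 2a/c + u/4` reads `2k{∞, s_u} = X_u + X_{u+4} + Y`, `Y = {∞, 4a/c + ½}` (for `u = 3` up to an
integer translate), whence `X_u − X_{u+4} = 2(k{∞, s_u} − X_{u+4}) − Y`; and `{∞, s_u}`, `X_{u+4}`,
`Y` all lie in `Λ(f)`: their denominators in lowest terms are `c/2`, `c`, `c/4`, all divisible by the
odd `N` (`modularSymbol_div_mem_periodLattice_of_dvd`: a cusp `p/q` in lowest terms with `N ∣ q` is
`γ′∞` for `γ′ = (p ∗; q ∗) ∈ Γ₀(N)`). The two `Y`'s cancel (`χ₈`) or add up to `−2Y` (`χ₈′`).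
Nothing here is specific to elliptic curves; BSD is not proved by this file.

References: [cite: Stevens1989, Lemma (5.4) and (5.6)–(5.7), pp. 97–98]
[cite: MazurTateTeitelbaum1986Invent, §I.4 (4.2)] [cite: Cremona1997, §2.8–2.9] [cite: Manin1972, §1.2 and Prop. 1.4]
-/

set_option autoImplicit false
set_option linter.dupNamespace false

noncomputable section

open scoped MatrixGroups ModularForm

open CongruenceSubgroup
  Literature.NumberTheory.EllipticCurves
  Literature.NumberTheory.EllipticCurves.ModularForms
  Summit.BirchSwinnertonDyer.Rank1Residual.ManinAdditive

namespace Summit.BirchSwinnertonDyer.BirchSwinnertonDyer.Theorems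

/-! ## 1. Cusps with denominator divisible by `N` -/

section CuspLattice

variable {N : ℕ} (f : CuspForm (Gamma0 N) 2)

/-- **A cusp `p/q` in lowest terms with `N ∣ q` gives a period**: `{∞, p/q}_f ∈ Λ(f)`, because
`p/q = γ∞` for `γ = (p −y; q x) ∈ Γ₀(N)` (`xp + yq = 1`), so `{∞, p/q}_f = {∞, γ∞}_f` is one of the
generators of `Λ(f)` (Manin 1972, Prop. 1.4; Cremona 1997, §2.1–2.2). [cite: Manin1972, Prop. 1.4] -/
theorem modularSymbol_div_mem_periodLattice_of_dvd {p q : ℤ} (hpq : IsCoprime p q) (hq0 : q ≠ 0)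
    (hNq : (N : ℤ) ∣ q) : modularSymbol f ((p : ℚ) / q) ∈ periodLattice f := by
  obtain ⟨x, y, hxy⟩ := hpq
  let A : Matrix (Fin 2) (Fin 2) ℤ := !![p, -y; q, x]
  have hdet : A.det = 1 := by
    rw [Matrix.det_fin_two_of]
    linear_combination hxy
  let γ : SL(2, ℤ) := ⟨A, hdet⟩
  have h00 : γ 0 0 = p := rfl
  have h10 : γ 1 0 = q := rfl
  have hγ : γ ∈ Gamma0 N := by
    rw [Gamma0_mem, h10]
    exact (ZMod.intCast_zmod_eq_zero_iff_dvd q N).mpr hNq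
  have hmem := cuspSymbol_mem_periodLattice f ⟨γ, hγ⟩
  have hc0 : ((⟨γ, hγ⟩ : Gamma0 N) : SL(2, ℤ)) 1 0 ≠ 0 := by
    change γ 1 0 ≠ 0
    rw [h10]
    exact hq0
  rw [cuspSymbol, if_neg hc0] at hmem
  change modularSymbol f (((γ 0 0 : ℤ) : ℚ) / ((γ 1 0 : ℤ) : ℚ)) ∈ periodLattice f at hmem
  rwa [h00, h10] at hmem

/-- Integer translates do not change a modular symbol: `{∞, r + z}_f = {∞, r}_f` (`z ∈ ℤ`), in the
form used below. [cite: Manin1972, §1.2] -/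
theorem modularSymbol_add_int [NeZero N] (r : ℚ) (z : ℤ) :
    modularSymbol f (r + z) = modularSymbol f r :=
  modularSymbol_add_intCast_holds f r z

end CuspLattice

/-! ## 2. The Hecke relation at `2`, paired at `u` and `u + 4` -/

section HeckeTwo

variable {N : ℕ} (f : CuspForm (Gamma0 N) 2)

/-- **Stevens' (5.6) in symbols**: if `2k · {∞, r} = {∞, r/2} + {∞, (r+1)/2} + {∞, 2r}` for all `r`
(the Hecke relation at `2` with eigenvalue `2k`), then for cusps `p = s/2`, `q = (s+1)/2`, `y = 2s`:
`{∞, p} − {∞, q} = 2 (k {∞, s} − {∞, q}) − {∞, y}`.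
[cite: Stevens1989, (5.6) p. 97] [cite: MazurTateTeitelbaum1986Invent, §I.4 (4.2)] -/
theorem modularSymbol_sub_eq_of_heckeTwo (k : ℤ)
    (hT₂ : ∀ r : ℚ, (2 * k : ℂ) * modularSymbol f r =
      ∑ j : Fin 2, modularSymbol f ((r + j) / 2) + modularSymbol f (2 * r))
    {p q s y : ℚ} (hp : p = s / 2) (hq : q = (s + 1) / 2) (hy : y = 2 * s) :
    modularSymbol f p - modularSymbol f q =
      2 * ((k : ℂ) * modularSymbol f s - modularSymbol f q) - modularSymbol f y := by
  have h := hT₂ s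
  rw [Fin.sum_univ_two, Fin.val_zero, Fin.val_one, Nat.cast_zero, Nat.cast_one, add_zero,
    ← hp, ← hq, ← hy] at h
  linear_combination (-1 : ℂ) * h

/-- An integer multiple of a period is a period. [elementary] -/
theorem intCast_mul_mem_periodLattice {z : ℂ} (hz : z ∈ periodLattice f) (k : ℤ) :
    (k : ℂ) * z ∈ periodLattice f := by
  rw [← zsmul_eq_mul]
  exact (periodLattice f).zsmul_mem hz k

end HeckeTwo

/-! ## 3. The cusps met at a generator `{∞, a/c}_{f ⊗ χ}`, `γ = (a b; c d) ∈ Γ₀(L)`, `64 N ∣ c` -/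

section Cusps

variable {N : ℕ} (f : CuspForm (Gamma0 N) 2)

/-- For `a` odd and coprime to an even `c₁` with `N ∣ c₁`, every cusp `(a + v c₁)/(2^j c₁)` (`v ∈ ℤ`,
`j ≥ 0`… here `e ∈ {2, 4, 8}`) is in lowest terms with denominator divisible by `N`, so its modular
symbol is a period of `f`. [cite: Manin1972, Prop. 1.4] -/
theorem modularSymbol_frac_mem_periodLattice {a c₁ : ℤ} (ha : ¬ 2 ∣ a) (hc₁ : 2 ∣ c₁) (hc₁0 : c₁ ≠ 0)
    (hac : IsCoprime a c₁) (hNc : (N : ℤ) ∣ c₁) (v : ℤ) (j : ℕ) :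
    modularSymbol f (((a + v * c₁ : ℤ) : ℚ) / ((2 ^ j * c₁ : ℤ) : ℚ)) ∈ periodLattice f := by
  refine modularSymbol_div_mem_periodLattice_of_dvd f ?_ (mul_ne_zero (pow_ne_zero _ two_ne_zero) hc₁0)
    (hNc.mul_left _)
  have hodd : ¬ 2 ∣ a + v * c₁ := fun h ↦ ha (by simpa using (Int.dvd_sub h (hc₁.mul_left v)))
  have h2 : IsCoprime (a + v * c₁) 2 :=
    ((Int.prime_two.irreducible.coprime_iff_not_dvd).mpr hodd).symm
  exact (h2.pow_right).mul_right (hac.add_mul_right_left v)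

/-- **The generator data**: for `γ = (a b; c d) ∈ Γ₀(L)` with `c ≠ 0`, `8² ∣ L`, `N ∣ L`, `N` odd:
`c = 8c₁` with `c₁ ≠ 0` even, `N ∣ c₁`, `a` odd and coprime to `c₁`. [folklore] -/
theorem exists_entry_eq_eight_mul {L : ℕ} (hN : N ∣ L) (hm : 8 ^ 2 ∣ L) (h2N : ¬ 2 ∣ N)
    (γ : Gamma0 L) (hc0 : (γ : SL(2, ℤ)) 1 0 ≠ 0) :
    ∃ c₁ : ℤ, (γ : SL(2, ℤ)) 1 0 = 8 * c₁ ∧ c₁ ≠ 0 ∧ 2 ∣ c₁ ∧ (N : ℤ) ∣ c₁ ∧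
      ¬ 2 ∣ (γ : SL(2, ℤ)) 0 0 ∧ IsCoprime ((γ : SL(2, ℤ)) 0 0) c₁ := by
  have h64 : (8 : ℤ) ^ 2 ∣ (γ : SL(2, ℤ)) 1 0 := by
    have := sq_dvd_entry_of_mem_Gamma0 (m := 8) hm γ.2
    exact_mod_cast this
  have hLc : (L : ℤ) ∣ (γ : SL(2, ℤ)) 1 0 :=
    (ZMod.intCast_zmod_eq_zero_iff_dvd _ _).mp (Gamma0_mem.mp γ.2)
  have hNc : (N : ℤ) ∣ (γ : SL(2, ℤ)) 1 0 := (Int.natCast_dvd_natCast.mpr hN).trans hLc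
  obtain ⟨c₂, hc₂⟩ := h64
  refine ⟨8 * c₂, by rw [hc₂]; ring, ?_, ⟨4 * c₂, by ring⟩, ?_, ?_, ?_⟩
  · intro h
    apply hc0
    rw [hc₂, show (8 : ℤ) ^ 2 * c₂ = 8 * (8 * c₂) by ring, h, mul_zero]
  · -- `N` odd and `N ∣ 64 c₂ = 8 · (8 c₂)`
    have hN8 : IsCoprime (N : ℤ) ((8 : ℕ) : ℤ) := by
      rw [Nat.isCoprime_iff_coprime]
      have h2 : Nat.Coprime 2 N := (Nat.Prime.coprime_iff_not_dvd Nat.prime_two).mpr h2N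
      simpa using (h2.symm.pow_right 3)
    rw [hc₂, show (8 : ℤ) ^ 2 * c₂ = (8 * c₂) * ((8 : ℕ) : ℤ) by push_cast; ring] at hNc
    exact hN8.dvd_of_dvd_mul_right hNc
  · -- `a` is odd: `a d − b c = 1` with `c` even
    intro h2a
    have hdet := det_entries (γ : SL(2, ℤ))
    have h2c : (2 : ℤ) ∣ (γ : SL(2, ℤ)) 1 0 := ⟨(8 : ℤ) ^ 2 / 2 * c₂, by rw [hc₂]; ring⟩
    have h1 : (2 : ℤ) ∣ 1 := by
      rw [← hdet]
      exact Int.dvd_sub (h2a.mul_right _) (h2c.mul_left _)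
    omega
  · -- `gcd(a, c₁) = 1` from `a d − b c = 1`
    have hdet := det_entries (γ : SL(2, ℤ))
    refine ⟨(γ : SL(2, ℤ)) 1 1, -((γ : SL(2, ℤ)) 0 1 * 8), ?_⟩
    rw [hc₂] at hdet
    linear_combination hdet

end Cusps

/-! ## 4. K1: `(g(χ)/2) · Λ(f ⊗ χ) ⊆ Λ(f)` for `χ` primitive mod `8`, `a₂(f) = 2k`, odd level -/

section EtaTwo

variable {N : ℕ} [NeZero N]

/-- **K1 on a generator** (Stevens 1989, (5.6)–(5.7) on `Γ₀`): for `f ∈ S₂(Γ₀(N))` of ODD level whose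
modular symbols satisfy the Hecke relation at `2` with EVEN eigenvalue `2k`, a primitive quadratic
character `χ` mod `8` (so `Σ_u χ(u)F(u) = F1 + εF3 − F5 − εF7`, `ε = ±1`), and a level `L` with `N ∣ L`,
`8² ∣ L`: `(g(χ)/2) · {∞, γ∞}_{f⊗χ} ∈ Λ(f)` for every `γ ∈ Γ₀(L)`.
[cite: Stevens1989, Lemma (5.4) and (5.6)–(5.7), pp. 97–98] -/
theorem half_gaussSum_mul_cuspSymbol_charTwist_mem_of_heckeTwo (L : ℕ) [NeZero L]
    (hN : N ∣ L) (hm : 8 ^ 2 ∣ L) {χ : DirichletCharacter ℂ 8} (hχ : χ.IsQuadratic)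
    (hprim : χ.IsPrimitive) {ε : ℤ} (hε : ε = 1 ∨ ε = -1)
    (hχsum : ∀ F : ZMod 8 → ℂ, ∑ u : ZMod 8, χ u * F u = F 1 + ε * F 3 - F 5 - ε * F 7)
    (f : CuspForm (Gamma0 N) 2) (h2N : ¬ 2 ∣ N) (k : ℤ)
    (hT₂ : ∀ r : ℚ, (2 * k : ℂ) * modularSymbol f r =
      ∑ j : Fin 2, modularSymbol f ((r + j) / 2) + modularSymbol f (2 * r))
    (γ : Gamma0 L) :
    gaussSum χ (ZMod.stdAddChar (N := 8)) / 2 * cuspSymbol (charTwist L hN hm hχ f) γ ∈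
      periodLattice f := by
  by_cases hc0 : (γ : SL(2, ℤ)) 1 0 = 0
  · rw [cuspSymbol, if_pos hc0, mul_zero]
    exact zero_mem _
  obtain ⟨c₁, hc, hc₁0, hc₁2, hNc₁, ha2, hac⟩ := exists_entry_eq_eight_mul hN hm h2N γ hc0
  rw [div_mul_eq_mul_div, gaussSum_mul_cuspSymbol_charTwist L hN hm hχ hprim f γ hc0, hχsum,
    twistShift_one_eight, twistShift_three_eight, twistShift_five_eight, twistShift_seven_eight]
  set a : ℤ := (γ : SL(2, ℤ)) 0 0 with ha_def
  set x : ℚ := ((γ : SL(2, ℤ)) 0 0 : ℚ) / (((γ : SL(2, ℤ)) 1 0 : ℤ) : ℚ) with hx_def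
  have hc₁Q : (c₁ : ℚ) ≠ 0 := by exact_mod_cast hc₁0
  have hx : x = (a : ℚ) / (8 * c₁) := by
    rw [hx_def, hc]
    push_cast
    rfl
  -- the five periods of `f` that occur
  have hmem : ∀ (v : ℤ) (j : ℕ),
      modularSymbol f (((a + v * c₁ : ℤ) : ℚ) / ((2 ^ j * c₁ : ℤ) : ℚ)) ∈ periodLattice f :=
    modularSymbol_frac_mem_periodLattice f ha2 hc₁2 hc₁0 hac hNc₁
  have hS1 : modularSymbol f (2 * x + 1 / 4) ∈ periodLattice f := by
    rw [show 2 * x + 1 / 4 = ((a + 1 * c₁ : ℤ) : ℚ) / ((2 ^ 2 * c₁ : ℤ) : ℚ) by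
      rw [hx]; push_cast; field_simp; ring]
    exact hmem 1 2
  have hS3 : modularSymbol f (2 * x + 3 / 4) ∈ periodLattice f := by
    rw [show 2 * x + 3 / 4 = ((a + 3 * c₁ : ℤ) : ℚ) / ((2 ^ 2 * c₁ : ℤ) : ℚ) by
      rw [hx]; push_cast; field_simp; ring]
    exact hmem 3 2
  have hX5 : modularSymbol f (x + 5 / 8) ∈ periodLattice f := by
    rw [show x + 5 / 8 = ((a + 5 * c₁ : ℤ) : ℚ) / ((2 ^ 3 * c₁ : ℤ) : ℚ) by
      rw [hx]; push_cast; field_simp]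
    exact hmem 5 3
  have hX7 : modularSymbol f (x + 7 / 8) ∈ periodLattice f := by
    rw [show x + 7 / 8 = ((a + 7 * c₁ : ℤ) : ℚ) / ((2 ^ 3 * c₁ : ℤ) : ℚ) by
      rw [hx]; push_cast; field_simp]
    exact hmem 7 3
  have hY : modularSymbol f (4 * x + 1 / 2) ∈ periodLattice f := by
    rw [show 4 * x + 1 / 2 = ((a + 1 * c₁ : ℤ) : ℚ) / ((2 ^ 1 * c₁ : ℤ) : ℚ) by
      rw [hx]; push_cast; field_simp; ring]
    exact hmem 1 1
  have hY3 : modularSymbol f (4 * x + 3 / 2) = modularSymbol f (4 * x + 1 / 2) := by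
    rw [show 4 * x + 3 / 2 = 4 * x + 1 / 2 + ((1 : ℤ) : ℚ) by push_cast; ring]
    exact modularSymbol_add_int f _ 1
  -- Stevens' (5.6) at `u = 1` and `u = 3`
  have P1 := modularSymbol_sub_eq_of_heckeTwo f k hT₂ (p := x + 1 / 8) (q := x + 5 / 8)
    (s := 2 * x + 1 / 4) (y := 4 * x + 1 / 2) (by ring) (by ring) (by ring)
  have P3 := modularSymbol_sub_eq_of_heckeTwo f k hT₂ (p := x + 3 / 8) (q := x + 7 / 8)
    (s := 2 * x + 3 / 4) (y := 4 * x + 3 / 2) (by ring) (by ring) (by ring)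
  rw [hY3] at P3
  rcases hε with rfl | rfl
  · -- `χ₈′`-shape: `F1 + F3 − F5 − F7`
    have hw : (modularSymbol f (x + 1 / 8) + ((1 : ℤ) : ℂ) * modularSymbol f (x + 3 / 8) -
        modularSymbol f (x + 5 / 8) - ((1 : ℤ) : ℂ) * modularSymbol f (x + 7 / 8)) / 2 =
        ((k : ℂ) * modularSymbol f (2 * x + 1 / 4) - modularSymbol f (x + 5 / 8)) +
          ((k : ℂ) * modularSymbol f (2 * x + 3 / 4) - modularSymbol f (x + 7 / 8)) -
          modularSymbol f (4 * x + 1 / 2) := by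
      push_cast
      linear_combination (1 / 2 : ℂ) * P1 + (1 / 2 : ℂ) * P3
    rw [hw]
    exact sub_mem (add_mem (sub_mem (intCast_mul_mem_periodLattice f hS1 k) hX5)
      (sub_mem (intCast_mul_mem_periodLattice f hS3 k) hX7)) hY
  · -- `χ₈`-shape: `F1 − F3 − F5 + F7`
    have hw : (modularSymbol f (x + 1 / 8) + ((-1 : ℤ) : ℂ) * modularSymbol f (x + 3 / 8) -
        modularSymbol f (x + 5 / 8) - ((-1 : ℤ) : ℂ) * modularSymbol f (x + 7 / 8)) / 2 =
        ((k : ℂ) * modularSymbol f (2 * x + 1 / 4) - modularSymbol f (x + 5 / 8)) -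
          ((k : ℂ) * modularSymbol f (2 * x + 3 / 4) - modularSymbol f (x + 7 / 8)) := by
      push_cast
      linear_combination (1 / 2 : ℂ) * P1 - (1 / 2 : ℂ) * P3
    rw [hw]
    exact sub_mem (sub_mem (intCast_mul_mem_periodLattice f hS1 k) hX5)
      (sub_mem (intCast_mul_mem_periodLattice f hS3 k) hX7)

/-- **K1: `(g(χ)/2) · Λ(f ⊗ χ) ⊆ Λ(f)`** — Stevens 1989 Lemma (5.4) WITH his factor `η = 2`, on `Γ₀`:
for `f ∈ S₂(Γ₀(N))` of odd level with the Hecke relation at `2` and even eigenvalue `2k`, a primitive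
quadratic `χ` mod `8` and a level `L` with `N ∣ L`, `8² ∣ L`, every `z ∈ Λ(f ⊗ χ)` has
`(g(χ)/2) z ∈ Λ(f)` (closure induction over the generators,
`half_gaussSum_mul_cuspSymbol_charTwist_mem_of_heckeTwo`).
[cite: Stevens1989, Lemma (5.4) and (5.6)–(5.7), pp. 97–98] -/
theorem half_gaussSum_mul_mem_periodLattice_of_heckeTwo (L : ℕ) [NeZero L]
    (hN : N ∣ L) (hm : 8 ^ 2 ∣ L) {χ : DirichletCharacter ℂ 8} (hχ : χ.IsQuadratic)
    (hprim : χ.IsPrimitive) {ε : ℤ} (hε : ε = 1 ∨ ε = -1)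
    (hχsum : ∀ F : ZMod 8 → ℂ, ∑ u : ZMod 8, χ u * F u = F 1 + ε * F 3 - F 5 - ε * F 7)
    (f : CuspForm (Gamma0 N) 2) (h2N : ¬ 2 ∣ N) (k : ℤ)
    (hT₂ : ∀ r : ℚ, (2 * k : ℂ) * modularSymbol f r =
      ∑ j : Fin 2, modularSymbol f ((r + j) / 2) + modularSymbol f (2 * r))
    {z : ℂ} (hz : z ∈ periodLattice (charTwist L hN hm hχ f)) :
    gaussSum χ (ZMod.stdAddChar (N := 8)) / 2 * z ∈ periodLattice f := by
  induction hz using AddSubgroup.closure_induction with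
  | mem w hw =>
    obtain ⟨γ, rfl⟩ := hw
    exact half_gaussSum_mul_cuspSymbol_charTwist_mem_of_heckeTwo L hN hm hχ hprim hε hχsum f h2N k
      hT₂ γ
  | zero =>
    rw [mul_zero]
    exact zero_mem _
  | add u v _ _ hu hv =>
    rw [mul_add]
    exact add_mem hu hv
  | neg u _ hu =>
    rw [mul_neg]
    exact neg_mem hu

/-- The character-sum shape for `χ₈` (`ε = −1`). [elementary] -/
theorem sum_χ₈_shape (F : ZMod 8 → ℂ) :
    ∑ u : ZMod 8, (ZMod.χ₈.ringHomComp (Int.castRingHom ℂ)) u * F u =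
      F 1 + ((-1 : ℤ) : ℂ) * F 3 - F 5 - ((-1 : ℤ) : ℂ) * F 7 := by
  rw [sum_χ₈_mul]
  push_cast
  ring

/-- The character-sum shape for `χ₈′` (`ε = 1`). [elementary] -/
theorem sum_χ₈'_shape (F : ZMod 8 → ℂ) :
    ∑ u : ZMod 8, (ZMod.χ₈'.ringHomComp (Int.castRingHom ℂ)) u * F u =
      F 1 + ((1 : ℤ) : ℂ) * F 3 - F 5 - ((1 : ℤ) : ℂ) * F 7 := by
  rw [sum_χ₈'_mul]
  push_cast
  ring

end EtaTwo

end Summit.BirchSwinnertonDyer.BirchSwinnertonDyer.Theorems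

end
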